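import Summits.BirchSwinnertonDyer.BirchSwinnertonDyer.Theorems.PrintCf2RubinValueTwoZetaSpanOfGenerators
import Summits.BirchSwinnertonDyer.BirchSwinnertonDyer.Theorems.PrintCf2RubinValueTwoRowTwoTwistedKummerInjective
import HarnessLib

/-!
# The norm from a compositum: `N_{ME/M}(y) = N_{E/E∩M}(y)` for `y ∈ E`, `E/k` finite Galois (`normOver (M ⊔ E) M = normOver E M` on `E`)

Cell `bsd-print-cf2`, WIDTH seat `bsd-line-cf2-p1-w5` g11 (prover-bsd-line-cf2-p1-w5-g11-0); the field-theoretic linchpin (N-sup) of steps (β5-2)–(β5-4) of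
the (LZ) blueprint behind hZC (`TwistedZeta.hZC_of_levelwise` p732796 → `hLZ_of_generators` p736566 → `hG1_of_canonical`) on the DECIDING child
stmt-BirchSwinnertonDyer-24721; `--supports` 24721 (helper, Theses-free). THEOREMS ONLY (no definition, no named fact, no instance, no `sorry`).
HONEST FRAMING: Galois theory (Krull correspondence for `K̄/k`, the finite correspondence on `E`); nothing here closes the crux; no summit statement
is proved by this seat; BSD is not proved by any of this.

WHY. Rubin's generators are `N_{F K(𝔣′)/F}(θ)` — norms from the compositum `F ⊔ K(𝔣′)` (`rubinGenerators`, `normOver (F ⊔ rayClassField K 𝔣′) F`),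
while de Shalit's distribution relations II.2.5 and Kato's normalisation live INSIDE the ray class tower (`relNorm = normOver (K(𝔤𝔩)) (K(𝔤))`). The
bridge is the classical `Gal(ME/M) ≅ Gal(E/E ∩ M)`: for `y ∈ E`, **`N_{M⊔E/M}(y) = N_{E/E∩M}(y)`**, i.e. `normOver (M ⊔ E) M ⟨y⟩ = normOver E M ⟨y⟩` read in
`K̄` (the tree's `galOver E M` is `Gal(E/E∩M)` by definition).

* `coe_restrictNormalHom_apply` — `↑((g|_E) x) = g • ↑x`;
* `mem_fixedField_map_galFixing_iff` — for `H = Gal(K̄/M)|_E ≤ Gal(E/k)`: `x ∈ E^H ⟺ ↑x ∈ M` (Krull: fixed by `Gal(K̄/M)` means in `M`);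
* `mem_galOver_iff_mem_map_galFixing` — `galOver E M = H` (finite Galois correspondence `fixingSubgroup (fixedField H) = H` on `E`);
* **`coe_normOver_sup_eq`** — `↑(normOver (M ⊔ E) M ⟨y, _⟩) = ↑(normOver E M ⟨y, _⟩)` for `y ∈ E` (coset representatives of `Gal(K̄/M)/Gal(K̄/ME)`,
  -w6 g8's `prod_smul_eq_normOver`, restrict to `E` bijectively onto `H`).

References: S. Lang, *Algebra* (2002) VI §1 Thm. 1.12 (`Gal(EM/M) ≅ Gal(E/E∩M)`); J. Neukirch, *Algebraic Number Theory* (1999) Ch. IV §1.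
-/

noncomputable section

open scoped Classical

-- the summit namespace `Summit.BirchSwinnertonDyer.BirchSwinnertonDyer` repeats the problem name by design (D-0017)
set_option linter.dupNamespace false
set_option autoImplicit false

open Field IntermediateField
open Literature.NumberTheory.GaloisRepresentations Literature.NumberTheory.GaloisRepresentations.LocalWeilDatum
open Literature.NumberTheory.ComplexMultiplication.EllipticUnits
open Summit.BirchSwinnertonDyer.BirchSwinnertonDyer.Theorems.PrintCf2
open Summit.BirchSwinnertonDyer.BirchSwinnertonDyer.Theorems.PrintCf2.RowTwo

namespace Summit.BirchSwinnertonDyer.BirchSwinnertonDyer.Theorems.PrintCf2.TwistedZeta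

variable {k : Type} [Field k] (E M : IntermediateField k (AlgebraicClosure k))

/-- **Restriction to a normal `E`, read in `K̄`**: `↑((g|_E) x) = g • ↑x` for `g ∈ Gal(K̄/k)`, `x ∈ E` (Mathlib `AlgEquiv.restrictNormalHom`).
[cite: NeukirchANT1999, Ch. IV §1 (1.1)] -/
theorem coe_restrictNormalHom_apply [Normal k E] (g : absoluteGaloisGroup k) (x : E) :
    ((((AlgEquiv.restrictNormalHom E).comp (absoluteGaloisGroup.toAlgEquiv k).toMonoidHom g) x : E) : AlgebraicClosure k) =
      g • (x : AlgebraicClosure k) :=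
  AlgEquiv.restrictNormal_commutes (absoluteGaloisGroup.toAlgEquiv k g) E x

/-- **`x ∈ E^H ⟺ ↑x ∈ M`** for `H = Gal(K̄/M)|_E` the image of `Gal(K̄/M)` in `Gal(E/k)` (`E/k` normal, `K̄/k` Galois): an element of `E` is fixed by every
restriction of an element of `Gal(K̄/M)` iff it is fixed by `Gal(K̄/M)` iff it lies in `M` (Krull's correspondence). [cite: NeukirchANT1999, Ch. IV §1 (1.2)] [cite: Lang2002, Ch. VI §1 Thm. 1.12] -/
theorem mem_fixedField_map_galFixing_iff [IsGalois k (AlgebraicClosure k)] [Normal k E] (x : E) :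
    x ∈ IntermediateField.fixedField ((galFixing k M).map ((AlgEquiv.restrictNormalHom E).comp (absoluteGaloisGroup.toAlgEquiv k).toMonoidHom)) ↔
      (x : AlgebraicClosure k) ∈ M := by
  rw [IntermediateField.mem_fixedField_iff]
  constructor
  · intro h
    refine mem_of_forall_mem_galFixing_smul_eq M fun g hg ↦ ?_
    rw [← coe_restrictNormalHom_apply E g x, h _ (Subgroup.mem_map_of_mem _ hg)]
  · rintro hxM f ⟨g, hg, rfl⟩
    apply Subtype.ext
    rw [coe_restrictNormalHom_apply E g x]
    exact (mem_galFixing_iff k).mp hg _ hxM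

/-- **`Gal(E/E∩M) = Gal(K̄/M)|_E`**: the tree's `galOver E M` (automorphisms of `E/k` fixing `E ∩ M` pointwise) is the image of `Gal(K̄/M)` in `Gal(E/k)`
(`E/k` finite normal, `K̄/k` Galois; finite Galois correspondence `fixingSubgroup (fixedField H) = H`). [cite: Lang2002, Ch. VI §1 Thm. 1.12] [cite: NeukirchANT1999, Ch. IV §1] -/
theorem mem_galOver_iff_mem_map_galFixing [IsGalois k (AlgebraicClosure k)] [FiniteDimensional k E] [Normal k E] (σ : E ≃ₐ[k] E) :
    σ ∈ galOver E M ↔ σ ∈ (galFixing k M).map ((AlgEquiv.restrictNormalHom E).comp (absoluteGaloisGroup.toAlgEquiv k).toMonoidHom) := by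
  set H : Subgroup (E ≃ₐ[k] E) := (galFixing k M).map ((AlgEquiv.restrictNormalHom E).comp (absoluteGaloisGroup.toAlgEquiv k).toMonoidHom)
    with hH
  rw [← IntermediateField.fixingSubgroup_fixedField H, IntermediateField.mem_fixingSubgroup_iff]
  constructor
  · intro hσ x hx
    have hxM : (x : AlgebraicClosure k) ∈ M := (mem_fixedField_map_galFixing_iff E M x).mp hx
    exact Subtype.ext (hσ x x.2 hxM)
  · intro hσ y hy hyM
    have hmem : (⟨y, hy⟩ : E) ∈ IntermediateField.fixedField H := (mem_fixedField_map_galFixing_iff E M ⟨y, hy⟩).mpr hyM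
    exact congrArg Subtype.val (hσ ⟨y, hy⟩ hmem)

/-- **`N_{M⊔E/M}(y) = N_{E/E∩M}(y)` for `y ∈ E`**, read in `K̄`: `↑(normOver (M ⊔ E) M ⟨y, _⟩) = ↑(normOver E M ⟨y, _⟩)` (`E/k` finite Galois, `M ⊔ E/k` finite
Galois, `K̄/k` Galois, `k` a number field). Proof: the left side is `∏ₓ s(x)·y` over representatives `s` of `Gal(K̄/M)/Gal(K̄/M⊔E)` (-w6 g8's `prod_smul_eq_normOver`);
restriction to `E` is a bijection from these cosets onto `Gal(K̄/M)|_E = Gal(E/E∩M)` (`Gal(K̄/M⊔E) = Gal(K̄/M) ∩ Gal(K̄/E)`), and the right side is the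
product over `Gal(E/E∩M)`. [cite: Lang2002, Ch. VI §1 Thm. 1.12] [cite: NeukirchANT1999, Ch. IV §1] -/
theorem coe_normOver_sup_eq [NumberField k] [IsGalois k (AlgebraicClosure k)] [FiniteDimensional k E] [IsGalois k E] [FiniteDimensional k ↥(M ⊔ E)]
    [IsGalois k ↥(M ⊔ E)] {y : AlgebraicClosure k} (hyE : y ∈ E) (hyME : y ∈ M ⊔ E) :
    ((normOver (M ⊔ E) M ⟨y, hyME⟩ : ↥(M ⊔ E)) : AlgebraicClosure k) = ((normOver E M ⟨y, hyE⟩ : E) : AlgebraicClosure k) := by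
  classical
  -- the coset space `Gal(K̄/M)/Gal(K̄/M⊔E)` and representatives
  have hW : IsOpen (galFixing k (M ⊔ E) : Set (absoluteGaloisGroup k)) := isOpen_galFixing k _
  haveI : (galFixing k (M ⊔ E)).FiniteIndex := finiteIndex_of_isOpen' hW
  haveI : ((galFixing k (M ⊔ E)).subgroupOf (galFixing k M)).FiniteIndex := inferInstance
  letI : Fintype (↥(galFixing k M) ⧸ (galFixing k (M ⊔ E)).subgroupOf (galFixing k M)) := Fintype.ofFinite _
  let s : ↥(galFixing k M) ⧸ (galFixing k (M ⊔ E)).subgroupOf (galFixing k M) → ↥(galFixing k M) := fun x ↦ Quotient.out x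
  have hs : ∀ x, (s x : ↥(galFixing k M) ⧸ (galFixing k (M ⊔ E)).subgroupOf (galFixing k M)) = x := fun x ↦ QuotientGroup.out_eq' x
  rw [← prod_smul_eq_normOver (le_sup_left : M ≤ M ⊔ E) hs ⟨y, hyME⟩]
  -- restriction to `E`
  set r : absoluteGaloisGroup k →* (E ≃ₐ[k] E) := (AlgEquiv.restrictNormalHom E).comp (absoluteGaloisGroup.toAlgEquiv k).toMonoidHom with hr
  set H : Subgroup (E ≃ₐ[k] E) := (galFixing k M).map r with hH
  have hrval : ∀ (g : absoluteGaloisGroup k) (x : E), ((r g x : E) : AlgebraicClosure k) = g • (x : AlgebraicClosure k) :=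
    fun g x ↦ coe_restrictNormalHom_apply E g x
  -- two elements of `Gal(K̄/M)` with the same restriction differ by `Gal(K̄/M⊔E)`
  have hker : ∀ g g' : galFixing k M, r g = r g' → (g : absoluteGaloisGroup k)⁻¹ * g' ∈ galFixing k (M ⊔ E) := by
    intro g g' hgg'
    rw [galFixing_sup]
    refine Subgroup.mem_inf.mpr ⟨(galFixing k M).mul_mem ((galFixing k M).inv_mem g.2) g'.2, (mem_galFixing_iff k).mpr fun x hx ↦ ?_⟩
    have h1 : (g : absoluteGaloisGroup k) • x = (g' : absoluteGaloisGroup k) • x := by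
      rw [← hrval g ⟨x, hx⟩, ← hrval g' ⟨x, hx⟩, hgg']
    rw [mul_smul, ← h1, inv_smul_smul]
  -- the product over the cosets is the product over `H`
  have hfin : (galOver E M).Finite := Set.toFinite _
  have hprod : ∏ x, ((s x : galFixing k M) : absoluteGaloisGroup k) • y = ∏ σ ∈ hfin.toFinset, ((σ ⟨y, hyE⟩ : E) : AlgebraicClosure k) := by
    refine Finset.prod_nbij (fun x ↦ r (s x)) (fun x _ ↦ ?_) (fun x _ x' _ hxx' ↦ ?_) (fun σ hσ ↦ ?_) (fun x _ ↦ (hrval _ ⟨y, hyE⟩).symm)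
    · rw [Set.Finite.mem_toFinset, mem_galOver_iff_mem_map_galFixing]
      exact Subgroup.mem_map_of_mem _ (s x).2
    · have hmem : (s x)⁻¹ * s x' ∈ (galFixing k (M ⊔ E)).subgroupOf (galFixing k M) := by
        rw [Subgroup.mem_subgroupOf, Subgroup.coe_mul, Subgroup.coe_inv]
        exact hker (s x) (s x') hxx'
      rw [← hs x, ← hs x']
      exact QuotientGroup.eq.mpr hmem
    · rw [Finset.mem_coe, Set.Finite.mem_toFinset, mem_galOver_iff_mem_map_galFixing] at hσ
      obtain ⟨g, hg, rfl⟩ := hσ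
      refine ⟨QuotientGroup.mk ⟨g, hg⟩, Finset.mem_coe.mpr (Finset.mem_univ _), ?_⟩
      -- `s [g] ≡ g (mod Gal(K̄/M⊔E))`, and `Gal(K̄/M⊔E)` acts trivially on `E`
      have hmem : (s (QuotientGroup.mk ⟨g, hg⟩))⁻¹ * ⟨g, hg⟩ ∈ (galFixing k (M ⊔ E)).subgroupOf (galFixing k M) :=
        QuotientGroup.eq.mp (hs _)
      rw [Subgroup.mem_subgroupOf, Subgroup.coe_mul, Subgroup.coe_inv] at hmem
      have hE : ((s (QuotientGroup.mk ⟨g, hg⟩) : absoluteGaloisGroup k))⁻¹ * g ∈ galFixing k E := galFixing_antitone k le_sup_right hmem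
      change r (s (QuotientGroup.mk ⟨g, hg⟩)) = r g
      ext x
      apply Subtype.ext_iff.mp
      apply Subtype.ext
      rw [hrval, hrval]
      have h2 := (mem_galFixing_iff k).mp hE (x : AlgebraicClosure k) x.2
      rw [mul_smul, inv_smul_eq_iff] at h2
      exact h2.symm
  rw [hprod, normOver, finprod_mem_eq_finite_toFinset_prod _ hfin, SubmonoidClass.coe_finsetProd]

end Summit.BirchSwinnertonDyer.BirchSwinnertonDyer.Theorems.PrintCf2.TwistedZeta

end
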